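import Literature.InformationTheory.QuantumCodes.LiftedProduct
import Literature.InformationTheory.QuantumCodes.BivariateBicycleCodes
import Literature.InformationTheory.QuantumCodes.TwoBlockGroupAlgebraCodes
import Literature.InformationTheory.QuantumCodes.HypergraphProduct
import Literature.InformationTheory.QuantumCodes.HyperbicycleCodes
import HarnessLib

/-!
# Two-block codes (GB, abelian 2BGA, BB, general-group 2BGA), hypergraph-product and hyperbicycle codes ARE lifted-product codes

Panteleev–Kalachev, *Quantum LDPC codes with almost linear minimum distance* [PanteleevKalachev2022LP]
(IEEE TIT 68 (2022) 213 = arXiv:2012.04068; held text `paper:arxiv-2012.04068`, chunks pNNNN), §III.D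
[chunk p0011 L43]: "One can easily verify that if we take `R = 𝔽₂ ≅ Mat₁(𝔽₂)` then LP codes coincide with
HP codes. We can also see that the generalized bicycle (GB) codes with two commuting `ℓ × ℓ` matrices `A`
and `B` given in (9) [§III.A, chunk p0010 L34-40: `H_X = [A, B]`, `H_Z = [Bᵀ, Aᵀ]`, `AB = BA`] are also a
special case of LP codes if we consider the matrices `A` and `B` as `1 × 1` matrices over `Mat_ℓ(𝔽₂)`";
§III.A [chunk p0010 L43]: "we can obtain a more general class of codes if `A` and `B` are some `ℓ × ℓ`
matrices representing elements from a group algebra `𝔽₂G` for an abelian group `G`". Lin–Pryadko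
[LinPryadko2024, §4.1 (arXiv:2306.16400 chunk p0009 L7-9, L53-59)]: "2BGA codes … can also be thought of as
the smallest LP codes", "2BGA codes are a degenerate case of LP codes with both matrices of dimension `1 × 1`".

The tree has the lifted-product construction `LiftedProduct.xMatrix/zMatrix` and the predicate
`IsLiftedProduct H_X H_Z` (`LiftedProduct.lean`) but, until now, no theorem placing the census families
inside it. This file PROVES (no named facts):

* `LiftedProduct.isLiftedProduct_twoBlock` — any two commuting square matrices `A, B` over a commutative
  ring with `2 = 0`: `IsLiftedProduct [A|B] [Bᵀ|Aᵀ]` (witnesses `l = |n|`, `m_A = n_A = m_B = n_B = 1`; the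
  LP ansatz `[A ⊗ I, −I ⊗ B]` carries a sign that the two-block form omits, whence `2 = 0`);
* `AbelianTwoBlock.isLiftedProduct` — `AbelianTwoBlock.HX/HZ a b` (circulants over any finite abelian
  group; GB = cyclic `G`) [PK22LP §III.A/§III.D];
* `BB.Code.isLiftedProduct` — bivariate-bicycle codes (`G = ℤ_ℓ × ℤ_m`);
* `TwoBlockGA.isLiftedProduct` — general-group 2BGA codes `H_X = [L(a)|R(b)]`, `H_Z = [R(b)ᵀ|L(a)ᵀ]`
  (`L(a)R(b) = R(b)L(a)`) [LinPryadko2024 §4.1];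
* `LiftedProduct.isLiftedProduct_hypergraphProduct` — "if we take `R = 𝔽₂ ≅ Mat₁(𝔽₂)` then LP codes
  coincide with HP codes": the tree's `HypergraphProduct.xMatrix/zMatrix H₁ H₂` is `LP(H₁, H₂)` with `ℓ = 1`
  [PK22LP §III.D] (appended 2026-08-27, qec-lit-3 g3);
* (private `IsLiftedProduct.submatrix_rows`: row re-indexing preserves the predicate) and
  `Hyperbicycle.isLiftedProduct` / `isLiftedProduct_one` / `isLiftedProduct_lit` — Kovalev–Pryadko hyperbicycle
  codes (`HyperbicycleCodes.lean`: block-twisted `xMatrix/zMatrix a b χ` for every unit `χ`, the printed `χ = 1`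
  case, and the literal two-sided twist) are `LP(A, B_χ)` over the ring of `c × c` circulants, `A = Σᵢ aᵢ xⁱ`,
  `B_χ = Σᵢ bᵢ x^{χ i}` [PK22LP §III.E p0012 L61: "QC LP codes are permutation equivalent to a special case of
  hyperbicycle codes … `χ = 1`"] (appended 2026-08-27, qec-lit-3 g3).

Not here: the converse statements (an LP code with `ℓ = 1` is an HP code, etc.), parameters.
-/

namespace Literature.InformationTheory.QuantumCodes

open Matrix
open scoped Kronecker

namespace LiftedProduct

section TwoBlock

variable {F : Type*} [CommRing F] {n : Type*} [Fintype n]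

/-- **Generalized-bicycle / two-block codes are lifted-product codes with `1 × 1` matrices.**
"the generalized bicycle (GB) codes with two commuting `ℓ × ℓ` matrices `A` and `B` given in (9)
[`H_X = [A, B]`, `H_Z = [Bᵀ, Aᵀ]`, `AB = BA`] are also a special case of LP codes if we consider the
matrices `A` and `B` as `1 × 1` matrices over `Mat_ℓ(𝔽₂)`."  Typed for any commutative ring with `2 = 0`
(the LP ansatz carries the sign `[A ⊗ I, −I ⊗ B]`, which the two-block form `[A | B]` omits) and any finite
index type `n` (`ℓ = |n|`). Proved with the explicit witnesses `l = |n|`, `m_A = n_A = m_B = n_B = 1`.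
[cite: PanteleevKalachev2022LP, §III.D (arXiv:2012.04068 chunk p0011 L43); §III.A eq. (9) (chunk p0010 L34-40)] -/
theorem isLiftedProduct_twoBlock (A B : Matrix n n F) (hAB : A * B = B * A) (h2 : (2 : F) = 0) :
    IsLiftedProduct (fromCols A B) (fromCols Bᵀ Aᵀ) := by
  classical
  have hneg : ∀ x : F, -x = x := fun x => by
    have : x + x = 0 := by rw [← two_mul, h2, zero_mul]
    exact neg_eq_of_add_eq_zero_left this
  let e : n ≃ Fin (Fintype.card n) := Fintype.equivFin n
  -- the `1 × 1` block matrices `(A)`, `(B)` over `Mat_l(F)` and the index bijection `n ≃ (Fin 1 × Fin 1) × Fin l`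
  let bA : Matrix (Fin 1) (Fin 1) (Matrix (Fin (Fintype.card n)) (Fin (Fintype.card n)) F) :=
    Matrix.of fun _ _ => Matrix.reindex e e A
  let bB : Matrix (Fin 1) (Fin 1) (Matrix (Fin (Fintype.card n)) (Fin (Fintype.card n)) F) :=
    Matrix.of fun _ _ => Matrix.reindex e e B
  let e1 : n ≃ (Fin 1 × Fin 1) × Fin (Fintype.card n) :=
    ⟨fun r => ((0, 0), e r), fun p => e.symm p.2, fun r => by simp, fun p => by
      rcases p with ⟨⟨i, j⟩, x⟩
      simp [Fin.fin_one_eq_zero i, Fin.fin_one_eq_zero j]⟩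
  refine ⟨Fintype.card n, 1, 1, 1, 1, bA, bB, e1, e1,
    (Equiv.sumCongr e1 e1).trans (Equiv.sumProdDistrib _ _ _).symm, ?_, ?_, ?_⟩
  · intro i j s t
    simp only [bA, bB, Matrix.of_apply, reindex_apply, Matrix.submatrix_mul_equiv, hAB]
  · ext r q
    rcases q with q | q
    · simp [xMatrix, xMatrixR, bA, bB, e1, fromCols_apply_inl, Matrix.kroneckerMap_apply]
    · simp [xMatrix, xMatrixR, bA, bB, e1, fromCols_apply_inr, Matrix.kroneckerMap_apply, hneg]
  · ext r q
    rcases q with q | q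
    · simp [zMatrix, zMatrixR, bA, bB, e1, fromCols_apply_inl, Matrix.kroneckerMap_apply]
    · simp [zMatrix, zMatrixR, bA, bB, e1, fromCols_apply_inr, Matrix.kroneckerMap_apply]

end TwoBlock

section HP

variable {V₁ E₁ V₂ E₂ : Type*} [Fintype V₁] [Fintype E₁] [Fintype V₂] [Fintype E₂]
  [DecidableEq V₁] [DecidableEq E₁] [DecidableEq V₂] [DecidableEq E₂]

/-- **Hypergraph-product codes are lifted-product codes over `Mat₁(𝔽₂) ≅ 𝔽₂`.** "One can easily verify
that if we take `R = 𝔽₂ ≅ Mat₁(𝔽₂)` then LP codes coincide with HP codes": the tree's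
`HypergraphProduct.xMatrix/zMatrix H₁ H₂` (`[H₁ ⊗ I | I ⊗ H₂]`, `[I ⊗ H₂ᵀ | H₁ᵀ ⊗ I]`) is `LP(A, B)` with
`ℓ = 1`, `A = H₁`, `B = H₂` read as matrices of `1 × 1` blocks (the LP sign is invisible over `𝔽₂`).
Proved with explicit witnesses. [cite: PanteleevKalachev2022LP, §III.D (arXiv:2012.04068 chunk p0011 L43)] -/
theorem isLiftedProduct_hypergraphProduct (H₁ : Matrix V₁ E₁ (ZMod 2)) (H₂ : Matrix V₂ E₂ (ZMod 2)) :
    IsLiftedProduct (HypergraphProduct.xMatrix H₁ H₂) (HypergraphProduct.zMatrix H₁ H₂) := by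
  classical
  let eV₁ := Fintype.equivFin V₁; let eE₁ := Fintype.equivFin E₁
  let eV₂ := Fintype.equivFin V₂; let eE₂ := Fintype.equivFin E₂
  -- `1 × 1`-block versions of `H₁`, `H₂`, Fin-indexed
  let c : ZMod 2 → Matrix (Fin 1) (Fin 1) (ZMod 2) := fun x => Matrix.of fun _ _ => x
  let A : Matrix (Fin (Fintype.card V₁)) (Fin (Fintype.card E₁)) (Matrix (Fin 1) (Fin 1) (ZMod 2)) :=
    Matrix.of fun i j => c (H₁ (eV₁.symm i) (eE₁.symm j))
  let B : Matrix (Fin (Fintype.card V₂)) (Fin (Fintype.card E₂)) (Matrix (Fin 1) (Fin 1) (ZMod 2)) :=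
    Matrix.of fun i j => c (H₂ (eV₂.symm i) (eE₂.symm j))
  -- index bijections (append the trivial block coordinate `0 : Fin 1`)
  let eX : V₁ × V₂ ≃ (Fin (Fintype.card V₁) × Fin (Fintype.card V₂)) × Fin 1 :=
    ⟨fun p => ((eV₁ p.1, eV₂ p.2), 0), fun q => (eV₁.symm q.1.1, eV₂.symm q.1.2),
      fun p => by simp, fun q => by rcases q with ⟨⟨i, j⟩, z⟩; simp [Fin.fin_one_eq_zero z]⟩
  let eZ : E₁ × E₂ ≃ (Fin (Fintype.card E₁) × Fin (Fintype.card E₂)) × Fin 1 :=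
    ⟨fun p => ((eE₁ p.1, eE₂ p.2), 0), fun q => (eE₁.symm q.1.1, eE₂.symm q.1.2),
      fun p => by simp, fun q => by rcases q with ⟨⟨i, j⟩, z⟩; simp [Fin.fin_one_eq_zero z]⟩
  let eL : E₁ × V₂ ≃ (Fin (Fintype.card E₁) × Fin (Fintype.card V₂)) × Fin 1 :=
    ⟨fun p => ((eE₁ p.1, eV₂ p.2), 0), fun q => (eE₁.symm q.1.1, eV₂.symm q.1.2),
      fun p => by simp, fun q => by rcases q with ⟨⟨i, j⟩, z⟩; simp [Fin.fin_one_eq_zero z]⟩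
  let eR : V₁ × E₂ ≃ (Fin (Fintype.card V₁) × Fin (Fintype.card E₂)) × Fin 1 :=
    ⟨fun p => ((eV₁ p.1, eE₂ p.2), 0), fun q => (eV₁.symm q.1.1, eE₂.symm q.1.2),
      fun p => by simp, fun q => by rcases q with ⟨⟨i, j⟩, z⟩; simp [Fin.fin_one_eq_zero z]⟩
  let eQ : (E₁ × V₂) ⊕ (V₁ × E₂) ≃
      ((Fin (Fintype.card E₁) × Fin (Fintype.card V₂)) ⊕ (Fin (Fintype.card V₁) × Fin (Fintype.card E₂))) × Fin 1 :=
    (Equiv.sumCongr eL eR).trans (Equiv.sumProdDistrib _ _ _).symm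
  refine ⟨1, _, _, _, _, A, B, eX, eZ, eQ, ?_, ?_, ?_⟩
  · intro i j s t
    ext a b
    simp [A, B, c, Matrix.mul_apply, mul_comm]
  · ext ⟨v₁, v₂⟩ q
    rcases q with ⟨ε₁, v₂'⟩ | ⟨v₁', ε₂⟩
    · by_cases h : v₂ = v₂'
      · subst h; simp [HypergraphProduct.xMatrix, xMatrix, xMatrixR, A, B, c, eX, eQ, eL, eR, Matrix.kroneckerMap_apply,
          Matrix.one_apply, Matrix.mul_apply]
      · simp [HypergraphProduct.xMatrix, xMatrix, xMatrixR, A, B, c, eX, eQ, eL, eR, Matrix.kroneckerMap_apply,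
          Matrix.mul_apply, h]
    · by_cases h : v₁ = v₁'
      · subst h; simp [HypergraphProduct.xMatrix, xMatrix, xMatrixR, A, B, c, eX, eQ, eL, eR, Matrix.kroneckerMap_apply]
      · simp [HypergraphProduct.xMatrix, xMatrix, xMatrixR, A, B, c, eX, eQ, eL, eR, Matrix.kroneckerMap_apply,
          h]
  · ext ⟨ε₁, ε₂⟩ q
    rcases q with ⟨ε₁', v₂⟩ | ⟨v₁, ε₂'⟩
    · by_cases h : ε₁ = ε₁'
      · subst h; simp [HypergraphProduct.zMatrix, zMatrix, zMatrixR, A, B, c, eZ, eQ, eL, eR, Matrix.kroneckerMap_apply,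
          Matrix.one_apply, Matrix.mul_apply]
      · simp [HypergraphProduct.zMatrix, zMatrix, zMatrixR, A, B, c, eZ, eQ, eL, eR, Matrix.kroneckerMap_apply,
          Matrix.mul_apply, h]
    · by_cases h : ε₂ = ε₂'
      · subst h; simp [HypergraphProduct.zMatrix, zMatrix, zMatrixR, A, B, c, eZ, eQ, eL, eR, Matrix.kroneckerMap_apply,
          Matrix.one_apply, Matrix.mul_apply]
      · simp [HypergraphProduct.zMatrix, zMatrix, zMatrixR, A, B, c, eZ, eQ, eL, eR, Matrix.kroneckerMap_apply,
          Matrix.mul_apply, h]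

end HP

end LiftedProduct

/-- Re-indexing the ROWS of `H_X` and `H_Z` (independently) preserves being a lifted-product code
(the predicate already quantifies over row/column bijections). [folklore] -/
private theorem IsLiftedProduct.submatrix_rows {F : Type*} [CommRing F] {RX RZ RX' RZ' Q : Type*}
    {HX : Matrix RX Q F} {HZ : Matrix RZ Q F} (h : IsLiftedProduct HX HZ) (f : RX' ≃ RX) (g : RZ' ≃ RZ) :
    IsLiftedProduct (HX.submatrix f id) (HZ.submatrix g id) := by
  obtain ⟨l, ma, na, mb, nb, A, B, eX, eZ, eQ, hc, hX, hZ⟩ := h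
  refine ⟨l, ma, na, mb, nb, A, B, f.trans eX, g.trans eZ, eQ, hc, ?_, ?_⟩
  · ext r q; rw [hX]; rfl
  · ext r q; rw [hZ]; rfl

/-! ### The census families -/

/-- **GB / abelian two-block codes are `1 × 1` lifted products**: for coefficient vectors `a, b : G → F`
over any finite abelian group `G` ("`A` and `B` … matrices representing elements from a group algebra `𝔽₂G`
for an abelian group `G`"), `H_X = [circulant a | circulant b]`, `H_Z = [(circulant b)ᵀ | (circulant a)ᵀ]`
form a lifted-product code (`2 = 0` in `F`). Proved (`circulant_mul_comm`).
[cite: PanteleevKalachev2022LP, §III.A (arXiv:2012.04068 chunk p0010 L43) and §III.D (chunk p0011 L43)] -/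
theorem AbelianTwoBlock.isLiftedProduct {G : Type*} [Fintype G] [AddCommGroup G] {F : Type*} [CommRing F]
    (a b : G → F) (h2 : (2 : F) = 0) :
    IsLiftedProduct (AbelianTwoBlock.HX a b) (AbelianTwoBlock.HZ a b) :=
  LiftedProduct.isLiftedProduct_twoBlock _ _ (circulant_mul_comm a b) h2

/-- **Bivariate-bicycle codes are `1 × 1` lifted products** (`G = ℤ_ℓ × ℤ_m`, `R = 𝔽₂[ℤ_ℓ × ℤ_m] ⊂ Mat_{ℓm}(𝔽₂)`).
Proved. [cite: PanteleevKalachev2022LP, §III.A (arXiv:2012.04068 chunk p0010 L43) and §III.D (chunk p0011 L43)] -/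
theorem BB.Code.isLiftedProduct {ℓ m : ℕ} [NeZero ℓ] [NeZero m] (C : BB.Code ℓ m) :
    IsLiftedProduct C.HX C.HZ :=
  AbelianTwoBlock.isLiftedProduct _ _ rfl

/-- **General-group 2BGA codes are the smallest LP codes**: "2BGA codes are a degenerate case of LP codes
with both matrices of dimension `1 × 1`" — `H_X = [L(a)|R(b)]`, `H_Z = [R(b)ᵀ|L(a)ᵀ]` with
`L(a) R(b) = R(b) L(a)` over any finite group `G` and commutative ring with `2 = 0`. Proved.
[cite: LinPryadko2024, §4.1 (arXiv:2306.16400 chunk p0009 L7-9, L53-59); PanteleevKalachev2022LP, §III.D (arXiv:2012.04068 chunk p0011 L43)] -/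
theorem TwoBlockGA.isLiftedProduct {G : Type*} [Group G] [Fintype G] {F : Type*} [CommRing F]
    (a b : G → F) (h2 : (2 : F) = 0) :
    IsLiftedProduct (TwoBlockGA.HX a b) (TwoBlockGA.HZ a b) :=
  LiftedProduct.isLiftedProduct_twoBlock _ _ (TwoBlockGA.leftMul_mul_rightMul_comm a b) h2

/-! ### Hyperbicycle codes -/

namespace Hyperbicycle

variable {c : ℕ} [NeZero c]
variable {R₁ N₁ R₂ N₂ : Type*} [Fintype R₁] [Fintype N₁] [Fintype R₂] [Fintype N₂]
  [DecidableEq R₁] [DecidableEq N₁] [DecidableEq R₂] [DecidableEq N₂]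

/-- **Hyperbicycle codes are lifted-product codes.** "QC LP codes are permutation equivalent to a special
case of hyperbicycle codes. If we let `χ = 1` in equation (19) from [KP13], then the obtained CSS code is
permutation equivalent to the code `LP(A,B)`; where `ℓ := c`, `A := Σᵢ aᵢ xⁱ`, `B := Σᵢ bᵢ xⁱ`."  Typed for the
tree's block-twisted matrices `xMatrix/zMatrix a b χ` and EVERY unit `χ`: the same bookkeeping exhibits them as
`LP(A, B_χ)` with `A_{uv} = Σᵢ (aᵢ)_{uv} xⁱ` and `(B_χ)_{βν} = Σᵢ (bᵢ)_{βν} x^{χ i}` (the block twist is the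
substitution `x ↦ x^χ` on the `b`-side, cf. `gbB`; `χ = 1` is the printed case, `isLiftedProduct_one`), all
`c × c` circulant blocks, which pairwise commute. Proved with explicit witnesses (`l = |ℤ_c| `, `m_A = |R₁|`,
`n_A = |N₁|`, `m_B = |R₂|`, `n_B = |N₂|`; rows `(β,k,u) ↦ ((u,β),k)`, `(ν,k',μ) ↦ ((μ,ν),k')`).
[cite: PanteleevKalachev2022LP, §III.E (arXiv:2012.04068 chunk p0012 L61); KovalevPryadko2013Hyperbicycle, §IV.A eq. (19) (arXiv:1212.6703 chunk p0009 L15-42)] -/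
theorem isLiftedProduct (a : ZMod c → Matrix R₁ N₁ (ZMod 2)) (b : ZMod c → Matrix R₂ N₂ (ZMod 2))
    (χ : (ZMod c)ˣ) : IsLiftedProduct (xMatrix a b χ) (zMatrix a b χ) := by
  classical
  let eC := Fintype.equivFin (ZMod c)
  let eR₁ := Fintype.equivFin R₁; let eN₁ := Fintype.equivFin N₁
  let eR₂ := Fintype.equivFin R₂; let eN₂ := Fintype.equivFin N₂
  -- the circulant blocks, re-indexed `ℤ_c ≃ Fin |ℤ_c|`
  let cA : R₁ → N₁ → Matrix (Fin (Fintype.card (ZMod c))) (Fin (Fintype.card (ZMod c))) (ZMod 2) :=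
    fun u v => Matrix.reindex eC eC (circulant fun s => a (-s) u v)
  let cB : R₂ → N₂ → Matrix (Fin (Fintype.card (ZMod c))) (Fin (Fintype.card (ZMod c))) (ZMod 2) :=
    fun β ν => Matrix.reindex eC eC (circulant fun s => b (↑χ⁻¹ * (-s)) β ν)
  let A : Matrix (Fin (Fintype.card R₁)) (Fin (Fintype.card N₁)) (Matrix _ _ (ZMod 2)) :=
    Matrix.of fun i j => cA (eR₁.symm i) (eN₁.symm j)
  let B : Matrix (Fin (Fintype.card R₂)) (Fin (Fintype.card N₂)) (Matrix _ _ (ZMod 2)) :=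
    Matrix.of fun i j => cB (eR₂.symm i) (eN₂.symm j)
  -- index bijections
  let eX : R₂ × ZMod c × R₁ ≃ (Fin (Fintype.card R₁) × Fin (Fintype.card R₂)) × Fin (Fintype.card (ZMod c)) :=
    ⟨fun r => ((eR₁ r.2.2, eR₂ r.1), eC r.2.1), fun p => (eR₂.symm p.1.2, eC.symm p.2, eR₁.symm p.1.1),
      fun r => by simp, fun p => by simp⟩
  let eZ : N₂ × ZMod c × N₁ ≃ (Fin (Fintype.card N₁) × Fin (Fintype.card N₂)) × Fin (Fintype.card (ZMod c)) :=
    ⟨fun r => ((eN₁ r.2.2, eN₂ r.1), eC r.2.1), fun p => (eN₂.symm p.1.2, eC.symm p.2, eN₁.symm p.1.1),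
      fun r => by simp, fun p => by simp⟩
  let eL : R₂ × ZMod c × N₁ ≃ (Fin (Fintype.card N₁) × Fin (Fintype.card R₂)) × Fin (Fintype.card (ZMod c)) :=
    ⟨fun q => ((eN₁ q.2.2, eR₂ q.1), eC q.2.1), fun p => (eR₂.symm p.1.2, eC.symm p.2, eN₁.symm p.1.1),
      fun q => by simp, fun p => by simp⟩
  let eR : N₂ × ZMod c × R₁ ≃ (Fin (Fintype.card R₁) × Fin (Fintype.card N₂)) × Fin (Fintype.card (ZMod c)) :=
    ⟨fun q => ((eR₁ q.2.2, eN₂ q.1), eC q.2.1), fun p => (eN₂.symm p.1.2, eC.symm p.2, eR₁.symm p.1.1),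
      fun q => by simp, fun p => by simp⟩
  let eQ := (Equiv.sumCongr eL eR).trans (Equiv.sumProdDistrib _ _ _).symm
  have hneg : ∀ x : ZMod 2, -x = x := by decide
  have htw : ∀ k j : ZMod c, -((↑χ⁻¹ : ZMod c) * (k - j)) = ↑χ⁻¹ * (j - k) := by intros; ring
  refine ⟨_, _, _, _, _, A, B, eX, eZ, eQ, ?_, ?_, ?_⟩
  · intro i j s t
    simp only [A, B, cA, cB, Matrix.of_apply, reindex_apply, Matrix.submatrix_mul_equiv, circulant_mul_comm]
  · ext ⟨β, k, u⟩ q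
    rcases q with ⟨β', j, v⟩ | ⟨ν, j, u'⟩
    · by_cases h : β = β'
      · subst h
        simp [xMatrix, xLeft, LiftedProduct.xMatrix, LiftedProduct.xMatrixR, A, B, cA, cB, eX, eQ, eL, eR,
          Matrix.kroneckerMap_apply, circulant_apply, neg_sub]
      · simp [xMatrix, xLeft, LiftedProduct.xMatrix, LiftedProduct.xMatrixR, A, B, cA, cB, eX, eQ, eL, eR,
          Matrix.kroneckerMap_apply, h]
    · by_cases h : u = u'
      · subst h
        simp [xMatrix, xRight, LiftedProduct.xMatrix, LiftedProduct.xMatrixR, A, B, cA, cB, eX, eQ, eL, eR,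
          Matrix.kroneckerMap_apply, circulant_apply, hneg, htw]
      · simp [xMatrix, xRight, LiftedProduct.xMatrix, LiftedProduct.xMatrixR, A, B, cA, cB, eX, eQ, eL, eR,
          Matrix.kroneckerMap_apply, h]
  · ext ⟨ν, k', μ⟩ q
    rcases q with ⟨β', j, v⟩ | ⟨ν', j, u'⟩
    · by_cases h : μ = v
      · subst h
        simp [zMatrix, zLeft, LiftedProduct.zMatrix, LiftedProduct.zMatrixR, A, B, cA, cB, eZ, eQ, eL, eR,
          Matrix.kroneckerMap_apply, circulant_apply, htw, LiftedProduct.blockStar_apply]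
      · simp [zMatrix, zLeft, LiftedProduct.zMatrix, LiftedProduct.zMatrixR, A, B, cA, cB, eZ, eQ, eL, eR,
          Matrix.kroneckerMap_apply, h, LiftedProduct.blockStar_apply]
    · by_cases h : ν = ν'
      · subst h
        simp [zMatrix, zRight, LiftedProduct.zMatrix, LiftedProduct.zMatrixR, A, B, cA, cB, eZ, eQ, eL, eR,
          Matrix.kroneckerMap_apply, circulant_apply, neg_sub, LiftedProduct.blockStar_apply]
      · simp [zMatrix, zRight, LiftedProduct.zMatrix, LiftedProduct.zMatrixR, A, B, cA, cB, eZ, eQ, eL, eR,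
          Matrix.kroneckerMap_apply, h, LiftedProduct.blockStar_apply]

/-- The printed case `χ = 1`: "If we let `χ = 1` in equation (19) from [KP13], then the obtained CSS code is
permutation equivalent to the code `LP(A,B)`; where `ℓ := c`, `A := Σᵢ aᵢ xⁱ`, `B := Σᵢ bᵢ xⁱ`." Proved.
[cite: PanteleevKalachev2022LP, §III.E (arXiv:2012.04068 chunk p0012 L61)] -/
theorem isLiftedProduct_one (a : ZMod c → Matrix R₁ N₁ (ZMod 2)) (b : ZMod c → Matrix R₂ N₂ (ZMod 2)) :
    IsLiftedProduct (xMatrix a b 1) (zMatrix a b 1) :=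
  isLiftedProduct a b 1

/-- The LITERAL printed two-sided twist `Iᵢ^(χ) = S_χ Iᵢ` in both blocks (`litXMatrix/litZMatrix`, which are
row permutations of the `χ = 1` matrices, `litXMatrix_eq_submatrix`) is a lifted-product code too, for every
unit `χ`. Proved. [cite: KovalevPryadko2013Hyperbicycle, §IV.A eqs. (19), (23) (arXiv:1212.6703 chunk p0009 L15-42, L85-90); PanteleevKalachev2022LP, §III.E (arXiv:2012.04068 chunk p0012 L61)] -/
theorem isLiftedProduct_lit (a : ZMod c → Matrix R₁ N₁ (ZMod 2)) (b : ZMod c → Matrix R₂ N₂ (ZMod 2))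
    (χ : (ZMod c)ˣ) : IsLiftedProduct (litXMatrix a b χ) (litZMatrix a b χ) := by
  rw [litXMatrix_eq_submatrix, litZMatrix_eq_submatrix]
  exact (isLiftedProduct_one a b).submatrix_rows (rowTwist χ R₂ R₁) (rowTwist χ⁻¹ N₂ N₁)

end Hyperbicycle

end Literature.InformationTheory.QuantumCodes
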